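import Summits.ResolutionOfSingularities.ResolutionOfSingularities.Theorems.FrobeniusClosingPatchingRelPerfectDepthLegalTrace
import Literature.AlgebraicGeometry.Resolution.BlowupDisjointCentreWeights
import HarnessLib

/-!
# Crux `PatchingRelPerfect` (stmt-ResolutionOfSingularities-16161), chain W5.2 — T6-E1b residual `LegalScopedDivisorReduction₃`,
# PHASE 2 closer (2b), spec D1: the state WITH AN INERT FACTOR — one host component at a time

[OURS · L1 W5.2 · res-L1-w52-lead-1 g5, hand #3b; spec `L/res-L1-w52-lead-1/PHASE2-STEPB-SPEC.md` D1] Replaces the role of NO printed item;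
NOT a statement of the manuscript under review; fact-free.

The host `X = V(D)` of the separation game is regular, hence the DISJOINT union of its integral components; the X-side bookkeeping of the
curve-move loop (spec D2–D3: divisorial points, DVR orders — `…DepthLegalOrderLaw`) wants an INTEGRAL host. So the game processes ONE
component `D` at a time and parks the others (and anything else already separated) in an INERT factor `N`: `H = N · (D · monomialIdeal L)`.
A legal move along a centre inside `V(D) ∩ Supp M` transports `N` by plain pull-back (`τᶜ(N, 0) = N𝒪`) and the core
`D · monomialIdeal L` by brick B1's `HostState.step` — NO hypothesis on `N` is needed for the move itself:

* `HostStateN H N D L` — the sibling of `HostState` with `fac : H = N * (D * monomialIdeal L)`; `toHostState` the core;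
* `HostStateN.le_mul_sq` — legality `H ≤ N · 𝓘(Z)²`;
* **`HostStateN.step`** — ONE MOVE: `HostStateN (τᶜ(H,2)) (N𝒪) (τᶜ(D,1)) (stepExp L τ 𝓘(Z) (w − 1))`;
* `HostStateN.isPureWeightedSeq_cons_factored` (new ideal `N𝒪 · τᶜ(D · M, 2)`); `HostStateN.of_hostState` (`N = ⊤`); `disjoint_step`.

AI-written; AI review is weaker than expert review.

## References
* E. Bierstone, D. Grigoriev, P. Milman, J. Włodarczyk, arXiv:1206.3090, Lemma 3.7.1 (multiplicativity of the controlled transform).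
  [BierstoneGrigorievMilmanWlodarczyk2011]
* J. Kollár, *Lectures on Resolution of Singularities* (2007), 3.30.2. [Kollar2007]
-/

-- `Summit.<Summit>.<Sub>.Theorems` with `Sub = Summit` (single-conjunct summit, D-0017)
set_option linter.dupNamespace false

noncomputable section

open CategoryTheory CategoryTheory.Limits AlgebraicGeometry TopologicalSpace IsLocalRing
open Literature.AlgebraicGeometry.Resolution Scheme.IdealSheafData

namespace Summit.ResolutionOfSingularities.ResolutionOfSingularities.Theorems

universe u

namespace DepthLegal

open WeightTwoB DepthTargets

variable {E : Scheme.{u}}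

/-- [OURS · L1 W5.2] **The state of the separation game with an INERT factor `N`**: `H = N · (D · monomialIdeal L)`, the active host `D` an
effective Cartier regular hypersurface (order-one generators), the boundary `boundaryOf L` snc; nothing is asked of `N`.
[cite: BierstoneGrigorievMilmanWlodarczyk2011, Lemma 3.7.1] -/
structure HostStateN [IsLocallyNoetherian E] (H N D : E.IdealSheafData) (L : List (E.IdealSheafData × ℕ)) : Prop where
  /-- the ambient scheme is regular -/
  regE : Scheme.IsRegular E
  /-- the factorisation inert · host · boundary monomial -/
  fac : H = N * (D * monomialIdeal L)
  /-- the host is an effective Cartier divisor -/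
  hostCartier : IsEffectiveCartier D
  /-- the host is a regular hypersurface: order-one generators -/
  hostHyp : ∀ x ∈ D.support, ∃ v : E.presheaf.stalk x,
    stalkIdeal D x = Ideal.span {v} ∧ v ∉ (maximalIdeal (E.presheaf.stalk x)) ^ 2
  /-- the boundary has simple normal crossings -/
  sncB : HasSNC (boundaryOf L)

namespace HostStateN

variable [IsLocallyNoetherian E] {H N D : E.IdealSheafData} {L : List (E.IdealSheafData × ℕ)} (S : HostStateN H N D L)
  {Z : Closeds E} {η : E} {E' : Scheme.{u}} {τ : E' ⟶ E}

include S in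
/-- The core state `D · monomialIdeal L` of brick B1. [folklore] -/
theorem toHostState : HostState (D * monomialIdeal L) D L :=
  { regE := S.regE, fac := rfl, hostCartier := S.hostCartier, hostHyp := S.hostHyp, sncB := S.sncB }

/-- A plain `HostState` is a `HostStateN` with inert factor `⊤`. [folklore] -/
theorem of_hostState {H₀ : E.IdealSheafData} (S₀ : HostState H₀ D L) : HostStateN H₀ ⊤ D L :=
  { regE := S₀.regE, fac := by rw [Scheme.IdealSheafData.top_mul]; exact S₀.fac, hostCartier := S₀.hostCartier,
    hostHyp := S₀.hostHyp, sncB := S₀.sncB }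

include S in
/-- **LEGALITY with the inert factor**: `H = N · (D · M) ≤ N · 𝓘(Z)²` (hence `H ≤ 𝓘(Z)²`) for a centre inside `V(D) ∩ Supp M`.
[cite: BierstoneGrigorievMilmanWlodarczyk2011, Lemma 3.2.1 (1)] -/
theorem le_mul_sq (hZX : (Z : Set E) ⊆ D.support) (hZM : (Z : Set E) ⊆ (monomialIdeal L).support) :
    H ≤ N * vanishingIdeal Z ^ 2 := by
  rw [S.fac]
  exact mul_le_mul' le_rfl (S.toHostState.le_sq hZX hZM)

omit [IsLocallyNoetherian E] in
/-- `N · A ≤ A` for ideal sheaves. [folklore] -/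
theorem mul_le_of_inert (N A : E.IdealSheafData) : N * A ≤ A :=
  Scheme.IdealSheafData.le_def.mpr fun U => by
    rw [Scheme.IdealSheafData.ideal_mul, Pi.mul_apply]; exact Ideal.mul_le_left

include S in
/-- **The inert factor rides along by pull-back**: `τᶜ(N · H₀, 2) = N𝒪 · τᶜ(H₀, 2)` for `H₀ = D · M ≤ 𝓘(Z)²`.
[cite: BierstoneGrigorievMilmanWlodarczyk2011, Lemma 3.7.1] -/
theorem controlledTransform_eq (hZX : (Z : Set E) ⊆ D.support) (hZM : (Z : Set E) ⊆ (monomialIdeal L).support)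
    (hτ : IsBlowup τ (vanishingIdeal Z)) :
    controlledTransform τ (vanishingIdeal Z) H 2 =
      N.comap τ * controlledTransform τ (vanishingIdeal Z) (D * monomialIdeal L) 2 := by
  haveI : IsLocallyNoetherian E' := hτ.isLocallyNoetherian
  have h0 : N.comap τ ≤ (vanishingIdeal Z).comap τ ^ 0 := by rw [pow_zero, Scheme.IdealSheafData.one_eq_top]; exact le_top
  have h2 : (D * monomialIdeal L).comap τ ≤ (vanishingIdeal Z).comap τ ^ 2 :=
    comap_le_comap_pow_of_le_pow (S.toHostState.le_sq hZX hZM) τ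
  rw [S.fac, show (2 : ℕ) = 0 + 2 from rfl, controlledTransform_mul hτ.isEffectiveCartier h0 h2, controlledTransform_zero]

include S in
/-- [OURS · L1 W5.2] **ONE MOVE with an inert factor.** Blowing up a regular irreducible closed centre `Z ⊆ V(D) ∩ Supp M` with normal
crossings with the boundary transports `HostStateN H N D L` to
`HostStateN (τᶜ(H,2)) (N𝒪) (τᶜ(D,1)) (stepExp L τ 𝓘(Z) (w − 1))`, `w = weightAt L η`. [cite: Kollar2007, 3.30.2]
[cite: BierstoneGrigorievMilmanWlodarczyk2011, Lemma 3.6.4 (4), Lemma 3.7.1] -/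
theorem step (hη : IsGenericPoint η (Z : Set E)) (hZ : Scheme.IsRegular (vanishingIdeal Z).subscheme)
    (hZX : (Z : Set E) ⊆ D.support) (hZM : (Z : Set E) ⊆ (monomialIdeal L).support)
    (hnc : HasSNCWith (boundaryOf L) (vanishingIdeal Z)) (hτ : IsBlowup τ (vanishingIdeal Z)) :
    @HostStateN E' hτ.isLocallyNoetherian (controlledTransform τ (vanishingIdeal Z) H 2) (N.comap τ)
      (controlledTransform τ (vanishingIdeal Z) D 1) (stepExp L τ (vanishingIdeal Z) (weightAt L η - 1)) := by
  haveI : IsLocallyNoetherian E' := hτ.isLocallyNoetherian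
  have S' := S.toHostState.step hη hZ hZX hZM hnc hτ
  exact
    { regE := S'.regE
      fac := by rw [S.controlledTransform_eq hZX hZM hτ, S'.fac]
      hostCartier := S'.hostCartier
      hostHyp := S'.hostHyp
      sncB := S'.sncB }

include S in
/-- The move as ONE pure-weight-two step appended to a running sequence, the new ideal in FACTORED form `N𝒪 · τᶜ(D · M, 2)`. [folklore] -/
theorem isPureWeightedSeq_cons_factored {E₀ : Scheme.{u}} {ρ : E ⟶ E₀} {H₀ : E₀.IdealSheafData} (hseq : IsPureWeightedSeq 2 ρ H₀ H)
    (hZ : Scheme.IsRegular (vanishingIdeal Z).subscheme) (hZX : (Z : Set E) ⊆ D.support)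
    (hZM : (Z : Set E) ⊆ (monomialIdeal L).support) (hτ : IsBlowup τ (vanishingIdeal Z)) :
    IsPureWeightedSeq 2 (τ ≫ ρ) H₀ (N.comap τ * controlledTransform τ (vanishingIdeal Z) (D * monomialIdeal L) 2) := by
  have hle : H ≤ vanishingIdeal Z ^ 2 := (S.le_mul_sq hZX hZM).trans (mul_le_of_inert _ _)
  have hcomap : H.comap τ = (vanishingIdeal Z).comap τ ^ 2 * (N.comap τ * controlledTransform τ (vanishingIdeal Z) (D * monomialIdeal L) 2) := by
    rw [← S.controlledTransform_eq hZX hZM hτ]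
    exact hτ.comap_eq_pow_mul_controlledTransform_of_le_pow hle
  exact IsPureWeightedSeq.cons τ ρ H₀ H _ (vanishingIdeal Z) hseq hZ hle hτ hcomap

omit [IsLocallyNoetherian E] in
/-- **Disjointness of the inert factor from the host is preserved by a move inside the host**: `Supp N𝒪 = τ⁻¹ Supp N` and
`Supp τᶜ(D,1) ⊆ τ⁻¹ Supp D`. [folklore] -/
theorem disjoint_step (hdisj : Disjoint (N.support : Set E) D.support) :
    Disjoint ((N.comap τ).support : Set E') (controlledTransform τ (vanishingIdeal Z) D 1).support := by
  rw [Set.disjoint_left]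
  intro x' hxN hxD
  have h1 : τ x' ∈ N.support := (mem_support_comap_iff τ N x').mp hxN
  have h2 : τ x' ∈ D.support := by
    have h := support_antitone (comap_le_controlledTransform τ (vanishingIdeal Z) D 1) hxD
    exact (mem_support_comap_iff τ D x').mp h
  exact Set.disjoint_left.mp hdisj h1 h2

end HostStateN

end DepthLegal

end Summit.ResolutionOfSingularities.ResolutionOfSingularities.Theorems

end
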